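import Mathlib.Data.Int.GCD
import Mathlib.Data.Real.Basic
import Mathlib.Data.Fintype.BigOperators
import Mathlib.Algebra.BigOperators.Ring.Finset
import Mathlib.Algebra.Order.BigOperators.Ring.Finset
import Mathlib.Algebra.Module.Defs
import Mathlib.Tactic.FieldSimp
import Mathlib.Tactic.Linarith
import Mathlib.Tactic.GCongr
import Mathlib.Tactic.Positivity
import Mathlib.Tactic.Ring
import Mathlib.Tactic.LinearCombination
import HarnessLib

/-!
# Coprime integer combinations of two (near-)uniform group elements are (near-)uniform

Topic `Computability/Cryptography` (post-processing of hidden-subgroup samples); theorem-only file, no named facts. In the class-group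
stage of the crux `LinnikCubicClassGroups.PureCubicClassGroupFBQP` (line `arakelov-giant-step-cycle`) two Fourier samples `ξ₁, ξ₂` of the
character group `Ĝ` are combined with REDUCED integer coefficients `c₁ ξ₁ + c₂ ξ₂`, `gcd(c₁, c₂) = 1` (`CubicClassPost.PostParams.coefs`),
to cancel an unknown real coupling. This file is the finite-group fact that makes the combination as good as a fresh sample:

* `card_filter_comb_eq` — for a finite additive commutative group `G` and `gcd(c₁,c₂) = 1`, every fibre of
  `(ξ₁, ξ₂) ↦ c₁ • ξ₁ + c₂ • ξ₂` has exactly `|G|` elements (Bézout: the map is onto; fibres are translates of the kernel);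
* `sum_filter_comb_mem_le` — if `ξ₁, ξ₂` are independent with pointwise weights `≤ (1+ε)/|G|`, then for every subset `H`,
  `P[c₁ξ₁ + c₂ξ₂ ∈ H] ≤ (1+ε)² |H|/|G|` (so a proper subgroup is hit with probability `≤ (1+ε)²/2`).
[Hallgren 2005, §4; Cheung–Mosca 2001, §3]

## References

* S. Hallgren, STOC 2005, §4. [Hallgren2005]
* K. K. H. Cheung, M. Mosca, QIC 1 (2001), §3. [CheungMosca2001]
-/

namespace Literature.Computability.Cryptography

namespace CoprimePairing

open Finset

variable {G : Type*} [AddCommGroup G]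

/-- **Bézout makes the coprime combination onto**: `c₁ • (a • y) + c₂ • (b • y) = y` when `a c₁ + b c₂ = 1`. [folklore] -/
theorem comb_bezout {c₁ c₂ a b : ℤ} (h : a * c₁ + b * c₂ = 1) (y : G) : c₁ • (a • y) + c₂ • (b • y) = y := by
  rw [← mul_zsmul, ← mul_zsmul, ← add_zsmul, mul_comm c₁ a, mul_comm c₂ b, h, one_zsmul]

variable [Fintype G] [DecidableEq G]

/-- **Every fibre of a coprime combination has `|G|` elements.** [folklore] -/
theorem card_filter_comb_eq {c₁ c₂ : ℤ} (hc : Int.gcd c₁ c₂ = 1) (y : G) :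
    ((univ : Finset (G × G)).filter (fun p => c₁ • p.1 + c₂ • p.2 = y)).card = Fintype.card G := by
  -- Bézout coefficients
  obtain ⟨a, b, hab⟩ : ∃ a b : ℤ, a * c₁ + b * c₂ = 1 := by
    have h := Int.gcd_eq_gcd_ab c₁ c₂
    rw [hc] at h
    refine ⟨Int.gcdA c₁ c₂, Int.gcdB c₁ c₂, ?_⟩
    push_cast at h
    linear_combination -h
  -- every fibre is a translate of the zero fibre
  have hfib : ∀ y : G, ((univ : Finset (G × G)).filter (fun p => c₁ • p.1 + c₂ • p.2 = y)).card =
      ((univ : Finset (G × G)).filter (fun p => c₁ • p.1 + c₂ • p.2 = 0)).card := by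
    intro y
    refine card_bij (fun p _ => (p.1 - a • y, p.2 - b • y)) ?_ ?_ ?_
    · intro p hp
      simp only [mem_filter, mem_univ, true_and] at hp ⊢
      rw [smul_sub, smul_sub, sub_add_sub_comm, hp, comb_bezout hab, sub_self]
    · intro p _ q _ hpq
      simp only [Prod.mk.injEq, sub_left_inj] at hpq
      exact Prod.ext hpq.1 hpq.2
    · intro q hq
      refine ⟨(q.1 + a • y, q.2 + b • y), ?_, by simp⟩
      simp only [mem_filter, mem_univ, true_and] at hq ⊢
      rw [smul_add, smul_add, add_add_add_comm, hq, comb_bezout hab, zero_add]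
  -- the fibres partition `G × G`, all of the same size `s`: `|G| s = |G|²`
  set s := ((univ : Finset (G × G)).filter (fun p => c₁ • p.1 + c₂ • p.2 = 0)).card with hs
  have hsum : ∑ y : G, ((univ : Finset (G × G)).filter (fun p => c₁ • p.1 + c₂ • p.2 = y)).card =
      Fintype.card (G × G) := by
    rw [← card_univ]
    exact (card_eq_sum_card_fiberwise (s := (univ : Finset (G × G))) (t := (univ : Finset G))
      (f := fun p : G × G => c₁ • p.1 + c₂ • p.2) (fun _ _ => mem_univ _)).symm
  simp_rw [hfib] at hsum
  rw [sum_const, card_univ, smul_eq_mul, Fintype.card_prod] at hsum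
  rw [hfib y]
  have hpos : 0 < Fintype.card G := Fintype.card_pos
  exact Nat.eq_of_mul_eq_mul_left hpos (hsum.trans (by ring))

/-- **Near-uniform inputs give a near-uniform combination**: if `w₁, w₂ ≥ 0` are pointwise `≤ (1+ε)/|G|`, then for every
`H ⊆ G`, `∑_{c₁ξ₁+c₂ξ₂ ∈ H} w₁(ξ₁) w₂(ξ₂) ≤ (1+ε)² |H| / |G|`. [cite: Hallgren2005, §4] -/
theorem sum_filter_comb_mem_le {c₁ c₂ : ℤ} (hc : Int.gcd c₁ c₂ = 1) (w₁ w₂ : G → ℝ) {ε : ℝ} (hε : 0 ≤ ε)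
    (h₁ : ∀ x, 0 ≤ w₁ x ∧ w₁ x ≤ (1 + ε) / Fintype.card G) (h₂ : ∀ x, 0 ≤ w₂ x ∧ w₂ x ≤ (1 + ε) / Fintype.card G)
    (H : Finset G) :
    ∑ p ∈ (univ : Finset (G × G)).filter (fun p => c₁ • p.1 + c₂ • p.2 ∈ H), w₁ p.1 * w₂ p.2 ≤
      (1 + ε) ^ 2 * H.card / Fintype.card G := by
  have hG : (0 : ℝ) < Fintype.card G := by exact_mod_cast (Fintype.card_pos : 0 < Fintype.card G)
  -- split over the value of the combination
  have hsplit : ((univ : Finset (G × G)).filter (fun p => c₁ • p.1 + c₂ • p.2 ∈ H)) =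
      H.biUnion (fun y => (univ : Finset (G × G)).filter (fun p => c₁ • p.1 + c₂ • p.2 = y)) := by
    ext p; simp [mem_biUnion, mem_filter]
  rw [hsplit, sum_biUnion]
  · calc ∑ y ∈ H, ∑ p ∈ (univ : Finset (G × G)).filter (fun p => c₁ • p.1 + c₂ • p.2 = y), w₁ p.1 * w₂ p.2
        ≤ ∑ y ∈ H, ∑ p ∈ (univ : Finset (G × G)).filter (fun p => c₁ • p.1 + c₂ • p.2 = y),
            ((1 + ε) / Fintype.card G) * ((1 + ε) / Fintype.card G) := by
          have hb : (0 : ℝ) ≤ (1 + ε) / Fintype.card G := by positivity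
          exact sum_le_sum fun y _ => sum_le_sum fun p _ => mul_le_mul (h₁ _).2 (h₂ _).2 (h₂ _).1 hb
      _ = ∑ y ∈ H, (Fintype.card G : ℝ) * (((1 + ε) / Fintype.card G) * ((1 + ε) / Fintype.card G)) := by
          refine sum_congr rfl fun y _ => ?_
          rw [sum_const, card_filter_comb_eq hc y, nsmul_eq_mul]
      _ = (1 + ε) ^ 2 * H.card / Fintype.card G := by
          rw [sum_const, nsmul_eq_mul]; field_simp
  · intro y _ y' _ hne
    simp only [Function.onFun]
    rw [disjoint_filter]
    intro p _ hp hp'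
    exact hne (hp.symm.trans hp')

end CoprimePairing

end Literature.Computability.Cryptography
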